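import Literature.AlgebraicGeometry.Resolution.GeneralizedStabilityHenselizedRational
import Literature.AlgebraicGeometry.Resolution.GeneralizedStabilityRankOneHenselized
import HarnessLib

/-!
# Generalized stability for `K(t)`: the value-transcendental case from `K(t)^h` (Kuhlmann 2010, §5, proof of (R4))

Topic: `Literature/AlgebraicGeometry/Resolution` (valued function fields). Companion of
`GeneralizedStabilityRankOneHenselized.lean` (the residue-transcendental case) in the
decomposition of the named fact `Kuhlmann2010Stability` (`ValuationDefect.lean`) = F.-V. Kuhlmann,
*Elimination of ramification I: The generalized stability theorem*, Trans. AMS 362 (2010)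
5697–5727 = arXiv:1003.5678, **Thm. 1.1**, along the printed proof (§5). The proof of (R4)
(p. 18 of arXiv:1003.5678) begins

> To complete our proof, we show that (R4) is true. Let `(F|K,v)` satisfy the conditions of
> (R4). Then there is a valuation-transcendental element `x ∈ F` and `F|K(x)` is finite. By
> Corollary 2.16 it suffices to prove (R4) under the additional assumption that `F|K` is
> rational with a valuation-transcendental generator. In view of Theorem 2.14, we can replace
> `(F,v)` by its henselization. More generally, we will now prove our assertion under the
> assumption that `(F|K,v)` is a henselized inertially generated function field of rank 1 and
> transcendence degree 1 with a valuation-transcendental generator over the algebraically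
> closed field `K`. Given an arbitrary finite extension `(E|F,v)`, we have to show that it is
> defectless.

This file renders this first move for `Kuhlmann2010StabilityRankOneValueTranscendental`
(`GeneralizedStabilityRankOne.lean`: (R4) for `F = K(t)` of rank one over an algebraically closed
`K` with a VALUE-transcendental generator): with **Thm. 2.14**
(`Kuhlmann2010DefectlessIffHenselization`) it reduces to the assertion of p. 18 for the
henselized rational function field `K(x)^h` (`henselizedAdjoin`,
`GeneralizedStabilityHenselizedRational.lean`) with a value-transcendental generator, which is
vendored as a NAMED FACT; the reduction is PROVED. The named fact is in turn the target of the
finite-Galois-level assembly from Ostrowski's lemma, the italicized statement of §5 and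
Lemma 5.5 (`Kuhlmann2010OstrowskiLemma`, `Kuhlmann2010HenselizedRationalImmediateExt`,
`Kuhlmann2010Lemma55ValueTranscendental`) carried out in the `GeneralizedStabilityRankOneVT*`
files that follow.

## Content

* `isRankOneValued_of_overrings` — the bridge between the two renderings of "rank 1" (§2.1:
  "if and only if `vK` is archimedean"): if `V ∩ E ≠ E` and the only overrings of `V ∩ E` in
  `E` are `V ∩ E` and `E`, then `(E, v)` has rank one in the archimedean sense
  (`IsRankOneValued`). PROVED (`exists_overring_of_not_mulArchimedean`).
* `IsRankOneValued.of_algebraic` — rank one passes to algebraic extensions inside `(Ω, V)`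
  (Lemma 2.1: `vE/vF'` is torsion), in particular from `K(x)` to `K(x)^h`
  (`isRankOneValued_henselizedAdjoin_of_adjoin`). PROVED.
* `isValueTranscendentalOver_fieldRange` — transport of value-transcendence from the typed
  hypothesis of (R4) to the image of `K` in `Ω`. PROVED.
* `Kuhlmann2010StabilityHenselizedRationalValueTranscendental` — NAMED FACT: the assertion of
  p. 18 for a henselized rational function field with a value-transcendental generator: `K` an
  algebraically closed subfield of the algebraically closed valued field `(Ω, V)`, `x ∈ Ω`
  value-transcendental over `K`, `(K(x)^h, V ∩ K(x)^h)` of rank one ⇒ it is a defectless field.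
* `Kuhlmann2010StabilityRankOneValueTranscendental.of_parts :
  Kuhlmann2010DefectlessIffHenselization → Kuhlmann2010StabilityHenselizedRationalValueTranscendental
  → Kuhlmann2010StabilityRankOneValueTranscendental` — PROVED, as in the residue-transcendental
  companion: extend `v` from `F = K(t)` to `Ω = F̃` (Chevalley), identify `F` with `K'(x) ⊆ Ω`,
  transport rank one (`rankOne_congr`, `isRankOneValued_of_overrings`, Lemma 2.1 for the
  algebraic extension `K'(x)^h|K'(x)`: `IsRankOneValued.of_algebraic`) and value-transcendence,
  apply the named fact to `K'(x)^h`, Thm. 2.14 to come back to `K'(x)`, and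
  `IsDefectlessField.congr` to come back to `F`.

## Sources

* F.-V. Kuhlmann, *Elimination of ramification I: The generalized stability theorem*, Trans.
  Amer. Math. Soc. 362 (2010) 5697–5727 = arXiv:1003.5678: §2.1 (rank; Lemma 2.1), §2.3
  (Thm. 2.14), §2.5 (henselized rational function fields, value-transcendental generators;
  (4.2): "`F = K(x)^h` is of rank 1 and `x` is value-transcendental over `K`"), §5 (Lemma 5.4
  (R4) and the proof of (R4), pp. 18–20).

## Rendering notes

* "of rank 1" is carried by `K(x)^h` in the named fact (as printed: "(F|K,v) … of rank 1"), in
  the archimedean rendering `IsRankOneValued` of `GeneralizedStabilityHenselizedRational.lean`;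
  the typed hypothesis of (R4) (overrings of `F°`) yields it through `rankOne_congr`,
  `isRankOneValued_of_overrings` and the passage to the algebraic extension `K(x)^h|K(x)`.
* What is NOT here: the proof of the named fact (pp. 18–20) — see the module docstring of
  `GeneralizedStabilityHenselizedRational.lean` for the plan of its assembly.
-/

noncomputable section

open IsLocalRing

namespace Literature.AlgebraicGeometry.Resolution

universe u

/-! ### Rank one: from overrings to the archimedean rendering -/

section RankOneBridge

variable {Ω : Type u} [Field Ω] (V : ValuationSubring Ω)

/-- **From two overrings to an archimedean value group** (Kuhlmann 2010, §2.1: "It has rank 1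
(i.e., its only convex subgroups are `{0}` and `vK`) if and only if `vK` is archimedean"): for a
subfield `E` of `(Ω, V)`, if `V ∩ E ≠ E` and the only overrings of `V ∩ E` in `E` are `V ∩ E`
and `E`, then `(E, v)` has rank one in the sense of `IsRankOneValued`. PROVED (a non-archimedean
value group produces a third overring, `exists_overring_of_not_mulArchimedean`).
[cite: Kuhlmann2010, Section 2.1] -/
theorem isRankOneValued_of_overrings (E : Subfield Ω) (h1 : V.comap (algebraMap E Ω) ≠ ⊤)
    (h2 : ∀ S : ValuationSubring E, V.comap (algebraMap E Ω) ≤ S →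
      S = V.comap (algebraMap E Ω) ∨ S = ⊤) :
    IsRankOneValued V E := by
  set O : ValuationSubring E := V.comap (algebraMap E Ω) with hOdef
  have hM : MulArchimedean O.ValueGroup := by
    by_contra hM
    obtain ⟨S, hOS, hSO, hST⟩ := exists_overring_of_not_mulArchimedean O hM
    rcases h2 S hOS with h | h
    · exact hSO h
    · exact hST h
  -- values in `E` versus values in `Ω`
  have hmono : StrictMono (valueGroupHom E V) := fun γ δ h =>
    lt_of_le_of_ne ((valueGroupHom_le_iff E V γ δ).mpr h.le)
      fun heq => h.ne (valueGroupHom_injective E V heq)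
  have hlt : ∀ y z : E, O.valuation y < O.valuation z ↔
      V.valuation (y : Ω) < V.valuation (z : Ω) := fun y z => by
    rw [← hmono.lt_iff_lt]
    exact Iff.rfl
  refine ⟨?_, fun a ha b hb hva => ?_⟩
  · -- non-triviality: an element of `E` outside `V`
    obtain ⟨y, hy⟩ : ∃ y : E, y ∉ O := by
      by_contra h
      push Not at h
      exact h1 (eq_top_iff.mpr fun y _ => h y)
    refine ⟨y, y.2, ?_⟩
    have : ¬ V.valuation (y : Ω) ≤ 1 := fun hle => hy ((V.valuation_le_one_iff _).mp hle)
    exact not_le.mp this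
  · have hva' : 1 < O.valuation ⟨a, ha⟩ := by
      have := (hlt 1 ⟨a, ha⟩).mpr (by simpa using hva)
      rwa [map_one] at this
    obtain ⟨n, hn⟩ := MulArchimedean.arch (O.valuation ⟨b, hb⟩) hva'
    refine ⟨n, ?_⟩
    have h := (valueGroupHom_le_iff E V _ _).mpr hn
    rw [map_pow, valueGroupHom_valuation, valueGroupHom_valuation] at h
    exact h

/-- **Rank one passes to algebraic extensions** inside `(Ω, V)` (Kuhlmann 2010, Lemma 2.1:
`vL/vK` is a torsion group for `L|K` algebraic, so `vL` is archimedean with `vK`): if `(F', v)`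
has rank one and `E ≥ F'` is algebraic over `F'` (elementwise), then `(E, v)` has rank one.
PROVED (`exists_valuation_pow_eq_of_isAlgebraic`). [cite: Kuhlmann2010, Lemma 2.1] -/
theorem IsRankOneValued.of_algebraic {F' E : Subfield Ω} (hle : F' ≤ E)
    (hF' : IsRankOneValued V F') (halg : ∀ a ∈ E, IsAlgebraic F' a) : IsRankOneValued V E := by
  obtain ⟨⟨a₀, ha₀, h1⟩, harch⟩ := hF'
  refine ⟨⟨a₀, hle ha₀, h1⟩, fun a ha b hb hva => ?_⟩
  by_cases hb0 : b = 0
  · exact ⟨0, by rw [hb0, map_zero]; exact zero_le⟩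
  have ha0 : a ≠ 0 := by
    rintro rfl
    rw [map_zero] at hva
    exact not_lt_zero hva
  -- `v(a)^n, v(b)^m` are values of elements `a', b'` of `F'`
  obtain ⟨n, hn, a', ha', hna⟩ := exists_valuation_pow_eq_of_isAlgebraic V (halg a ha) ha0
  obtain ⟨m, hm, b', hb', hmb⟩ := exists_valuation_pow_eq_of_isAlgebraic V (halg b hb) hb0
  rw [map_pow] at hna hmb
  have hva' : 1 < V.valuation a' := by
    rw [← hna]
    exact one_lt_pow₀ hva hn
  obtain ⟨k, hk⟩ := harch a' ha' b' hb' hva'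
  -- `v(b)^m = v(b') ≤ v(a')^k = v(a)^(n k)` forces `v(b) ≤ v(a)^(n k)`
  refine ⟨n * k, ?_⟩
  by_contra hlt
  push Not at hlt
  have h1a : 1 ≤ V.valuation a ^ (n * k) := one_le_pow₀ hva.le
  have : V.valuation a ^ (n * k) < V.valuation b ^ m :=
    calc V.valuation a ^ (n * k) ≤ (V.valuation a ^ (n * k)) ^ m := le_self_pow₀ h1a hm
      _ < V.valuation b ^ m := pow_lt_pow_left₀ hlt zero_le hm
  rw [hmb, pow_mul, hna] at this
  exact absurd hk (not_le.mpr this)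

/-- Rank one passes from `K(x)` to `K(x)^h` (a separable-algebraic extension, Lemma 2.2).
[cite: Kuhlmann2010, Lemma 2.1] -/
theorem isRankOneValued_henselizedAdjoin_of_adjoin (K : Subfield Ω) (x : Ω)
    (h : IsRankOneValued V (IntermediateField.adjoin K ({x} : Set Ω)).toSubfield) :
    IsRankOneValued V (henselizedAdjoin V K x) :=
  h.of_algebraic V (adjoin_le_henselizedAdjoin V K x) fun _ hc =>
    (isSeparable_of_mem_henselization V _ hc).isIntegral.isAlgebraic

end RankOneBridge

/-! ### The assertion of p. 18 for `K(x)^h`, value-transcendental generator (named fact) -/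

/-- NAMED FACT — **Kuhlmann 2010, §5, proof of (R4): a henselized rational function field of
rank one with a value-transcendental generator over an algebraically closed field is a
defectless field.** P. 18: "In view of Theorem 2.14, we can replace `(F,v)` by its
henselization. More generally, we will now prove our assertion under the assumption that
`(F|K,v)` is a henselized inertially generated function field of rank 1 and transcendence degree
1 with a valuation-transcendental generator over the algebraically closed field `K`. Given an
arbitrary finite extension `(E|F,v)`, we have to show that it is defectless" — proved on
pp. 18–20 (ramification theory: `E.F^r|F^r` is a tower of normal extensions of degree `p`,
realised over a finite `N ⊆ F^r`; Lemma 2.27; Prop. 2.18; Cor. 4.2 resp. Prop. 3.1 for each step;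
the italicized statement "henselized inertially generated function fields of rank 1 … do not
admit proper immediate algebraic extensions"; Lemma 5.5; induction with Lemma 2.13). Vendored for
the henselized RATIONAL function field `F = K(x)^h = henselizedAdjoin V K x` (§2.5: "henselized
rational with generator `x` if `F = K(x)^h`") with a VALUE-transcendental generator `x` ((4.2):
"`F = K(x)^h` is of rank 1 and `x` is value-transcendental over `K`"), in the ambient rendering
of `Henselization.lean`: `(Ω, V)` an algebraically closed valued field, `K ≤ Ω` a subfield which
is an algebraically closed field (valued by `V ∩ K`), `x ∈ Ω` value-transcendental over `K`
(`IsValueTranscendentalOver`), `(K(x)^h, V ∩ K(x)^h)` of rank one (`IsRankOneValued`, §2.1);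
then `(K(x)^h, V ∩ K(x)^h)` is a defectless field. (In residue characteristic `0` this is an
instance of Cor. 2.12.) A finite-Galois-level assembly from `Kuhlmann2010OstrowskiLemma`,
`Kuhlmann2010HenselizedRationalImmediateExt` and `Kuhlmann2010Lemma55ValueTranscendental`
(`GeneralizedStabilityHenselizedRational.lean`) is in preparation; until it lands users take
`(h : Kuhlmann2010StabilityHenselizedRationalValueTranscendental)`.
[cite: Kuhlmann2010, Section 5, proof of (R4) (pp. 18–20 of arXiv:1003.5678)] -/
def Kuhlmann2010StabilityHenselizedRationalValueTranscendental : Prop :=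
  ∀ (Ω : Type u) [Field Ω] [IsAlgClosed Ω] (V : ValuationSubring Ω) (K : Subfield Ω),
    IsAlgClosed K → ∀ x : Ω, IsValueTranscendentalOver V K x →
    IsRankOneValued V (henselizedAdjoin V K x) →
    IsDefectlessField (henselizedAdjoin V K x)
      (V.comap (algebraMap (henselizedAdjoin V K x) Ω))

/-! ### (R4) for `K(t)`, `t` value-transcendental, from Thm. 2.14 and the named fact -/

section Transport

variable {K F Ω : Type u} [Field K] [Field F] [Field Ω] [Algebra K F] [Algebra F Ω]
  [Algebra K Ω] [IsScalarTower K F Ω] (V : ValuationSubring Ω)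

/-- **Value-transcendence is transported to the ambient field**: if `n·v(t) ∉ vK` in
`(F, V ∩ F)`, then the image of `t` in `(Ω, V)` is value-transcendental over the image of `K`
(values in `F` embed into values in `Ω`, `valueGroupHom`). [folklore] -/
theorem isValueTranscendentalOver_fieldRange {t : F}
    (hvt : ∀ n : ℕ, 0 < n → ∀ c : K, (V.comap (algebraMap F Ω)).valuation t ^ n ≠
      (V.comap (algebraMap F Ω)).valuation (algebraMap K F c)) :
    IsValueTranscendentalOver V (algebraMap K Ω).fieldRange (algebraMap F Ω t) := by
  rintro n hn _ ⟨c, rfl⟩ h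
  apply hvt n hn c
  apply valueGroupHom_injective F V
  rw [map_pow, valueGroupHom_valuation, valueGroupHom_valuation, ← IsScalarTower.algebraMap_apply]
  exact h

end Transport

/-- **Kuhlmann 2010, (R4) for `F = K(t)` of rank one with a value-transcendental generator over
an algebraically closed `K`, from Thm. 2.14 and the assertion of p. 18 for `K(t)^h`** ("In view
of Theorem 2.14, we can replace `(F,v)` by its henselization"). PROVED: extend `v` from `F` to
the algebraic closure `Ω = F̃` (Chevalley, `exists_valuationSubring_comap_eq`); the image
`E ⊆ Ω` of `F` is `K'(x)` for the image `K'` of `K` (algebraically closed) and `x` of `t`;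
`x` is value-transcendental over `K'` (`isValueTranscendentalOver_fieldRange`), `(E, V ∩ E)` has
rank one with `(F, F°)` (`rankOne_congr`), hence so has `E^h` (`isRankOneValued_of_overrings`,
`isRankOneValued_henselizedAdjoin_of_adjoin`); the named fact makes `(E^h, V ∩ E^h)` a defectless
field, Thm. 2.14 (`Kuhlmann2010DefectlessIffHenselization`) makes `(E, V ∩ E)` one, and
`IsDefectlessField.congr` transports this back to `(F, F°)`.
[cite: Kuhlmann2010, Section 5, Lemma 5.4 (R4) and proof of (R4) (p. 18)] -/
theorem Kuhlmann2010StabilityRankOneValueTranscendental.of_parts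
    (hA : Kuhlmann2010DefectlessIffHenselization.{u})
    (hB : Kuhlmann2010StabilityHenselizedRationalValueTranscendental.{u}) :
    Kuhlmann2010StabilityRankOneValueTranscendental.{u} := by
  intro K F _ _ _ _ O t hO hrk hvt hgen
  classical
  -- fix an extension `V` of `v` to the algebraic closure `F̃`
  obtain ⟨V, hV⟩ := exists_valuationSubring_comap_eq (Ω := AlgebraicClosure F) O
  subst hV
  -- the image `E ⊆ F̃` of `F` and `ψ : F ≃ E`
  let ψ : F ≃+* (algebraMap F (AlgebraicClosure F)).fieldRange :=
    RingEquiv.ofBijective (algebraMap F (AlgebraicClosure F)).rangeRestrictField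
      (algebraMap F (AlgebraicClosure F)).rangeRestrictField_bijective
  have hOψ : V.comap (algebraMap F (AlgebraicClosure F)) =
      (V.comap (algebraMap (algebraMap F (AlgebraicClosure F)).fieldRange
        (AlgebraicClosure F))).comap ψ.toRingHom := by
    ext y
    simp only [ValuationSubring.mem_comap]
    exact Iff.rfl
  -- the image `K'` of `K`, an algebraically closed subfield of `F̃`
  have hK'ac : IsAlgClosed (algebraMap K (AlgebraicClosure F)).fieldRange :=
    IsAlgClosed.of_ringEquiv K _
      (RingEquiv.ofBijective (algebraMap K (AlgebraicClosure F)).rangeRestrictField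
        (algebraMap K (AlgebraicClosure F)).rangeRestrictField_bijective)
  -- `x`, the image of `t`, is value-transcendental over `K'`
  have hxvt : IsValueTranscendentalOver V (algebraMap K (AlgebraicClosure F)).fieldRange
      (algebraMap F (AlgebraicClosure F) t) :=
    isValueTranscendentalOver_fieldRange V hvt
  -- `E = K'(x)`
  have hEeq : (algebraMap F (AlgebraicClosure F)).fieldRange =
      (IntermediateField.adjoin (algebraMap K (AlgebraicClosure F)).fieldRange
        ({algebraMap F (AlgebraicClosure F) t} : Set (AlgebraicClosure F))).toSubfield := by
    have h1 : (IsScalarTower.toAlgHom K F (AlgebraicClosure F)).fieldRange =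
        IntermediateField.adjoin K ({algebraMap F (AlgebraicClosure F) t} : Set (AlgebraicClosure F)) := by
      rw [AlgHom.fieldRange_eq_map, ← hgen, IntermediateField.adjoin_map, Set.image_singleton]
      rfl
    have h2 : (algebraMap F (AlgebraicClosure F)).fieldRange =
        (IsScalarTower.toAlgHom K F (AlgebraicClosure F)).fieldRange.toSubfield := by
      ext y
      simp only [RingHom.mem_fieldRange, IntermediateField.mem_toSubfield, AlgHom.mem_fieldRange]
      exact Iff.rfl
    rw [h2, h1, IntermediateField.adjoin_toSubfield, IntermediateField.adjoin_toSubfield,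
      range_algebraMap_subfield, RingHom.coe_fieldRange]
  -- `(E, V ∩ E)` has rank one, hence so has `E^h = K'(x)^h`
  obtain ⟨hE1, hE2⟩ := rankOne_congr ψ hOψ hO hrk
  have hr : IsRankOneValued V (algebraMap F (AlgebraicClosure F)).fieldRange :=
    isRankOneValued_of_overrings V _ hE1 hE2
  rw [hEeq] at hr
  have hrh := isRankOneValued_henselizedAdjoin_of_adjoin V _ _ hr
  -- the named fact for `E^h = K'(x)^h`, and Thm. 2.14
  have hdefE : IsDefectlessField (algebraMap F (AlgebraicClosure F)).fieldRange
      (V.comap (algebraMap (algebraMap F (AlgebraicClosure F)).fieldRange (AlgebraicClosure F))) := by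
    rw [hA (AlgebraicClosure F) V _, hEeq]
    exact hB (AlgebraicClosure F) V _ hK'ac _ hxvt hrh
  -- back to `(F, F°)` along `ψ`
  refine IsDefectlessField.congr ψ.symm ?_ hdefE
  rw [hOψ]
  exact (comap_comap_ringEquiv_symm ψ _).symm

end Literature.AlgebraicGeometry.Resolution
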